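import Summits.SmoothPoincare4.SmoothPoincare4.Theses.CongruenceShadows

/-!
# SmoothPoincare4 / CongruenceShadows — `ArtinGates` (support)

Settles item stmt-SmoothPoincare4-14857 of route CongruenceShadows:
`ArtinGates : (CongruenceApproximable → HeegaardHandlebodyCongruenceClosed → ShadowApproximation) ∧
  (NilpotentShadowsStandard → NilpotentApproximation → NormalFormStablyTrivial)`
("the two remaining Artin gates are sound").

Pure logic over `Literature/Topology/FourManifolds/GroupTrisections.lean`; no named facts are used,
the only import is the route file.

* (SEP) Given a Waldhausen-normalised `(3+3m, m+1)` group trisection `K` of the trivial group with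
  standard characteristic finite shadows, `CongruenceApproximable` supplies `α, ρ` with
  `α N₀ = K₀`, `α N₁ = K₁`, `α (ρ N₂) = K₂` (`N = s4Kernels.stabilizeIter m`) and `ρ` congruent to a
  product `x ∘ c` (`x ∈ Stab N₀ ∩ Stab N₁`, `c ∈ Stab N₂`) modulo every characteristic finite-index
  subgroup; `HeegaardHandlebodyCongruenceClosed` upgrades this to an honest factorisation
  `ρ = x ∘ c`, and `φ := α ∘ x` is the required isomorphism `N ≅ K`:
  `φ N₀ = α (x N₀) = α N₀ = K₀`, likewise for `N₁`, and
  `φ N₂ = α (x N₂) = α (x (c N₂)) = α (ρ N₂) = K₂`.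
* (UNIPOTENT) Verbatim the proof of `GateLogic_proof`
  (`Theorems/CongruenceShadowsGateLogic.lean`) with nilpotent shadows: `NilpotentShadowsStandard`
  feeds `NilpotentApproximation`, giving `α : N ≅ K`, and `K.IsStablyTrivial` holds with `n = 0`,
  `m' = m`, `h := rfl` and `α⁻¹`.
-/

-- the prescribed namespace `Summit.<P>.<Sub>.…` duplicates `SmoothPoincare4` (P = Sub)
set_option linter.dupNamespace false

namespace Summit.SmoothPoincare4.SmoothPoincare4.Theorems

open Summit.SmoothPoincare4.SmoothPoincare4.Theses.CongruenceShadows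
open Literature.Topology.FourManifolds

/-- Settles stmt-SmoothPoincare4-14857 (`ArtinGates`, support of route CongruenceShadows):
`(CongruenceApproximable → HeegaardHandlebodyCongruenceClosed → ShadowApproximation) ∧
 (NilpotentShadowsStandard → NilpotentApproximation → NormalFormStablyTrivial)`.
(SEP) take `α, ρ` from `CongruenceApproximable`; `HeegaardHandlebodyCongruenceClosed` turns the
level-wise products into `ρ = x ∘ c` with `x N₀ = N₀`, `x N₁ = N₁`, `c N₂ = N₂`; then `φ := α ∘ x`
carries `N = s4Kernels.stabilizeIter m` to `K` (`φ N₂ = α x c N₂ = α ρ N₂ = K₂`).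
(UNIPOTENT) `NilpotentShadowsStandard` supplies the nilpotent shadows `NilpotentApproximation`
needs; the resulting `α : N ≅ K` gives `K.IsStablyTrivial` with `n = 0`, `m' = m`, `h := rfl`
and `α⁻¹` (as in `GateLogic_proof`). [folklore] -/
theorem ArtinGates_proof :
    Summit.SmoothPoincare4.SmoothPoincare4.Theses.CongruenceShadows.ArtinGates := by
  unfold ArtinGates
  refine ⟨?_, ?_⟩
  · -- (SEP) closure ∧ closedness ⇒ approximation
    intro hCA hHH m K hK hnorm hsh
    obtain ⟨α, ρ, h0, h1, h2, hlev⟩ := hCA m K hK hnorm hsh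
    obtain ⟨x, c, hx0, hx1, hc2, hρ⟩ := hHH m ρ hlev
    have htrans : (x.trans α).toMonoidHom = α.toMonoidHom.comp x.toMonoidHom :=
      MonoidHom.ext fun _ => rfl
    have hρ' : ρ.toMonoidHom = x.toMonoidHom.comp c.toMonoidHom := MonoidHom.ext hρ
    have hx2 : (s4Kernels.stabilizeIter m 2).map x.toMonoidHom =
        (s4Kernels.stabilizeIter m 2).map ρ.toMonoidHom := by
      rw [hρ', ← Subgroup.map_map, hc2]
    refine ⟨x.trans α, fun i => ?_⟩
    rw [htrans, ← Subgroup.map_map]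
    fin_cases i
    · show ((s4Kernels.stabilizeIter m 0).map x.toMonoidHom).map α.toMonoidHom = K 0
      rw [hx0, h0]
    · show ((s4Kernels.stabilizeIter m 1).map x.toMonoidHom).map α.toMonoidHom = K 1
      rw [hx1, h1]
    · show ((s4Kernels.stabilizeIter m 2).map x.toMonoidHom).map α.toMonoidHom = K 2
      rw [hx2, h2]
  · -- (UNIPOTENT) nilpotent blindness ∧ nilpotent approximation ⇒ X, as in `GateLogic_proof`
    intro hS hA m K hK hnorm
    obtain ⟨α, hα⟩ := hA m K hK hnorm (hS m K hK)
    refine ⟨0, m, rfl, α.symm, fun i => ?_⟩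
    have hcomp : α.symm.toMonoidHom.comp α.toMonoidHom = MonoidHom.id _ :=
      MonoidHom.ext fun γ => by simp
    change (K i).map α.symm.toMonoidHom = s4Kernels.stabilizeIter m i
    rw [← hα i, Subgroup.map_map, hcomp, Subgroup.map_id]

end Summit.SmoothPoincare4.SmoothPoincare4.Theorems
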